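import Summits.CriticalPhenomena.PercolationContinuityZ3.Theorems.PercGamblersRuinVerticalGamblersRuinDeterministicTime
import Summits.CriticalPhenomena.PercolationContinuityZ3.Theorems.PercGamblersRuinVerticalGamblersRuinStubForwardKolmogorov

/-!
# Route `PercGamblersRuin`, crux `VerticalGamblersRuin` (stmt-CriticalPhenomena-10642):
# stub `stub_pathFunctionalBasics` — the elementary algebra of the quenched path functional

Helper file for the stub `stub_pathFunctionalBasics` of the line `registered` (skeleton rev 8) of
the crux `PercGamblersRuin.VerticalGamblersRuin`.

Setting (QUENCHED: the configuration `ω` is fixed, no measure theory).  `N_ω(x)` is the set of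
lattice neighbours `y ∼ x` of `ℤ³` with `s(x, y)` open in `ω`.  The PATH FUNCTIONAL
`E ω T x G = E^ω_x[G [X_0, …, X_T]]` of the simple random walk on the open lattice edges of `ω`
started at `x` (a SUB-probability: mass is only lost at a start without open lattice neighbour,
`0/0 = 0`) is pinned by the first-step recursion `hE0 : E ω 0 x G = G [x]` and
`hEs : E ω (T+1) x G = (∑_{y ∈ N_ω(x)} E ω T y (l ↦ G (x :: l))) / #N_ω(x)`.
`𝒫_ω` / `𝒦_ω` are the unkilled / killed-outside-`(-m, m)` one-step averaging operators (pinned by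
their formulas), `𝒫_ω^T`, `𝒦_ω^T` their `Nat.iterate`s.

Statement proved (exact registered signature), for all `ω`, `T`, `x`:
(1) `E ω T x` is monotone in `G`; (2) linear in `G`; (3) nonnegative on nonnegative `G`;
(4) mass `E ω T x 1 ≤ 1`; (5) mass `= 1` from a start with an open lattice neighbour;
(6) SUPPORT: `E ω T x G` only depends on `G` restricted to lists of length `T+1` with head `x`;
(7) LINK `(𝒫_ω^T f)(x) = E ω T x (l ↦ f x_T)`;
(8) LINK `(𝒦_ω^T f)(x) = E ω T x (l ↦ (∏_{t<T} 1_{-m < h(x_t) < m}) · f x_T)`.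

Proof: everything by induction on `T` from `hE0`/`hEs` (generalising over the start and the
functional), in the abstract setting of a neighbour structure `N : V → Finset V` and a functional
`F : ℕ → V → (List V → ℝ) → ℝ` pinned by the recursion (namespace `StubPathFunctionalBasics`;
monotonicity (1) and mass one (5) are `StubForwardKolmogorov.mono` /
`StubForwardKolmogorov.mass_one` of the landed sibling stub `stub_forwardKolmogorov`).
(5) uses that `N_ω` is symmetric (adjacency of `zdGraph 3` is symmetric and `s(x, y) = s(y, x)`),
so every site entered has an open neighbour, namely the previous site.  (7): `𝒫^{T+1} f =
𝒫 (𝒫^T f)` (`Function.iterate_succ_apply'`) versus `hEs` and `(x :: l)_{T+1} = l_T`.  (8): the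
same, after factoring the path indicator of `x :: l` over `t < T+1` as `1_{ins x} · (indicator of
l over t < T)` and pulling the constant factor out of `F` (homogeneity).

## References

* R. Lyons, Y. Peres, *Probability on Trees and Networks*, Cambridge University Press (2016),
  §2.1 (path expectations of network random walks, first-step recursion).
-/

noncomputable section

namespace Summit.CriticalPhenomena.PercolationContinuityZ3.Theorems.VerticalGamblersRuin

open MeasureTheory Filter Topology
open Literature.Probability.Percolation Literature.Probability.LatticeModels
open scoped Classical

namespace StubPathFunctionalBasics

variable {V : Type*} {v₀ : V} {N : V → Finset V} {F : ℕ → V → (List V → ℝ) → ℝ}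

/-! ### The path functional pinned by its first-step recursion: order and linear structure -/

/-- **Homogeneity** of a path functional `F` pinned by the first-step recursion
`F 0 x G = G [x]`, `F (T+1) x G = (∑_{y ∈ N x} F T y (l ↦ G (x :: l))) / #N x`:
`F T x (c • G) = c • F T x G`. -/
theorem smul (hF0 : ∀ x G, F 0 x G = G [x])
    (hFs : ∀ T x G, F (T + 1) x G = (∑ y ∈ N x, F T y (fun l => G (x :: l))) / ((N x).card : ℝ))
    (T : ℕ) (x : V) (c : ℝ) (G : List V → ℝ) : F T x (fun l => c * G l) = c * F T x G := by
  induction T generalizing x G with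
  | zero => rw [hF0, hF0]
  | succ T ih =>
    rw [hFs, hFs, mul_div_assoc', Finset.mul_sum]
    exact congrArg (· / _) (Finset.sum_congr rfl fun y _ => ih y _)

/-- **Additivity**: `F T x (G + G') = F T x G + F T x G'`. -/
theorem add (hF0 : ∀ x G, F 0 x G = G [x])
    (hFs : ∀ T x G, F (T + 1) x G = (∑ y ∈ N x, F T y (fun l => G (x :: l))) / ((N x).card : ℝ))
    (T : ℕ) (x : V) (G G' : List V → ℝ) :
    F T x (fun l => G l + G' l) = F T x G + F T x G' := by
  induction T generalizing x G G' with
  | zero => rw [hF0, hF0, hF0]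
  | succ T ih =>
    rw [hFs, hFs, hFs, ← add_div, ← Finset.sum_add_distrib]
    exact congrArg (· / _) (Finset.sum_congr rfl fun y _ => ih y _ _)

/-- **Linearity**: `F T x (a • G + b • G') = a • F T x G + b • F T x G'`. -/
theorem linear (hF0 : ∀ x G, F 0 x G = G [x])
    (hFs : ∀ T x G, F (T + 1) x G = (∑ y ∈ N x, F T y (fun l => G (x :: l))) / ((N x).card : ℝ))
    (T : ℕ) (x : V) (G G' : List V → ℝ) (a b : ℝ) :
    F T x (fun l => a * G l + b * G' l) = a * F T x G + b * F T x G' := by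
  rw [add hF0 hFs T x (fun l => a * G l) (fun l => b * G' l), smul hF0 hFs, smul hF0 hFs]

/-- **Nonnegativity**: `F T x G ≥ 0` for `G ≥ 0`. -/
theorem nonneg (hF0 : ∀ x G, F 0 x G = G [x])
    (hFs : ∀ T x G, F (T + 1) x G = (∑ y ∈ N x, F T y (fun l => G (x :: l))) / ((N x).card : ℝ))
    (T : ℕ) (x : V) {G : List V → ℝ} (h : ∀ l, 0 ≤ G l) : 0 ≤ F T x G := by
  induction T generalizing x G with
  | zero => rw [hF0]; exact h _
  | succ T ih =>
    rw [hFs]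
    exact div_nonneg (Finset.sum_nonneg fun y _ => ih y fun l => h (x :: l)) (Nat.cast_nonneg _)

/-! ### Mass (mass one from a start with a neighbour is `StubForwardKolmogorov.mass_one`) -/

/-- **Mass at most one**: `F T x 1 ≤ 1` (an average of numbers `≤ 1`, with `0/0 = 0`). -/
theorem mass_le_one (hF0 : ∀ x G, F 0 x G = G [x])
    (hFs : ∀ T x G, F (T + 1) x G = (∑ y ∈ N x, F T y (fun l => G (x :: l))) / ((N x).card : ℝ))
    (T : ℕ) (x : V) : F T x (fun _ => 1) ≤ 1 := by
  induction T generalizing x with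
  | zero => rw [hF0]
  | succ T ih =>
    rw [hFs]
    refine div_le_one_of_le₀ ?_ (Nat.cast_nonneg _)
    calc ∑ y ∈ N x, F T y (fun _ => (1 : ℝ)) ≤ ∑ _y ∈ N x, (1 : ℝ) :=
          Finset.sum_le_sum fun y _ => ih y
      _ = ((N x).card : ℝ) := by rw [Finset.sum_const, nsmul_eq_mul, mul_one]

/-! ### Support -/

/-- **Support**: `F T x G` only depends on the values of `G` at lists of length `T + 1` starting
with `x`. -/
theorem congr_path (hF0 : ∀ x G, F 0 x G = G [x])
    (hFs : ∀ T x G, F (T + 1) x G = (∑ y ∈ N x, F T y (fun l => G (x :: l))) / ((N x).card : ℝ))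
    (T : ℕ) (x : V) {G G' : List V → ℝ}
    (h : ∀ l : List V, l.length = T + 1 → l.getD 0 v₀ = x → G l = G' l) :
    F T x G = F T x G' := by
  induction T generalizing x G G' with
  | zero => rw [hF0, hF0]; exact h _ rfl List.getD_cons_zero
  | succ T ih =>
    rw [hFs, hFs]
    refine congrArg (· / _) (Finset.sum_congr rfl fun y _ => ih y fun l hl _ => ?_)
    exact h (x :: l) (by rw [List.length_cons, hl]) List.getD_cons_zero

/-! ### Links with the iterated averaging operators -/

/-- **Link with the unkilled operator**: for `Ψ f x = (∑_{y ∈ N x} f y) / #N x`,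
`(Ψ^[T] f) x = F T x (l ↦ f l_T)`. -/
theorem iterate_full (hF0 : ∀ x G, F 0 x G = G [x])
    (hFs : ∀ T x G, F (T + 1) x G = (∑ y ∈ N x, F T y (fun l => G (x :: l))) / ((N x).card : ℝ))
    {Ψ : (V → ℝ) → V → ℝ} (hΨ : ∀ f x, Ψ f x = (∑ y ∈ N x, f y) / ((N x).card : ℝ))
    (T : ℕ) (f : V → ℝ) (x : V) : (Ψ^[T] f) x = F T x (fun l => f (l.getD T v₀)) := by
  induction T generalizing x with
  | zero => rw [Function.iterate_zero_apply, hF0, List.getD_cons_zero]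
  | succ T ih =>
    rw [Function.iterate_succ_apply', hΨ, hFs]
    simp only [List.getD_cons_succ, ih]

/-- **Link with the killed operator**: for `Φ f x = 1_{ins x} · (∑_{y ∈ N x} f y) / #N x` and the
path indicator `I T l = ∏_{t < T} 1_{ins l_t}` (pinned by `hI1`/`hI0`),
`(Φ^[T] f) x = F T x (l ↦ I T l · f l_T)`. -/
theorem iterate_killed (hF0 : ∀ x G, F 0 x G = G [x])
    (hFs : ∀ T x G, F (T + 1) x G = (∑ y ∈ N x, F T y (fun l => G (x :: l))) / ((N x).card : ℝ))
    {ins : V → Prop} [DecidablePred ins] {Φ : (V → ℝ) → V → ℝ}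
    (hΦ : ∀ f x, Φ f x = if ins x then (∑ y ∈ N x, f y) / ((N x).card : ℝ) else 0)
    {I : ℕ → List V → ℝ} (hI1 : ∀ T l, (∀ t < T, ins (l.getD t v₀)) → I T l = 1)
    (hI0 : ∀ T l, ¬ (∀ t < T, ins (l.getD t v₀)) → I T l = 0)
    (T : ℕ) (f : V → ℝ) (x : V) : (Φ^[T] f) x = F T x (fun l => I T l * f (l.getD T v₀)) := by
  induction T generalizing x with
  | zero =>
    rw [Function.iterate_zero_apply, hF0, List.getD_cons_zero,
      hI1 0 [x] fun t ht => absurd ht (Nat.not_lt_zero t), one_mul]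
  | succ T ih =>
    -- consing the path indicator: `I (T+1) (x :: l) = 1_{ins x} * I T l`
    have hcons : ∀ l, I (T + 1) (x :: l) = (if ins x then 1 else 0) * I T l := by
      intro l
      by_cases hx : ins x
      · rw [if_pos hx, one_mul]
        by_cases hl : ∀ t < T, ins (l.getD t v₀)
        · rw [hI1 T l hl, hI1]
          intro t ht
          cases t with
          | zero => rwa [List.getD_cons_zero]
          | succ t => rw [List.getD_cons_succ]; exact hl t (by omega)
        · rw [hI0 T l hl, hI0]
          intro h'
          exact hl fun t ht => by
            have := h' (t + 1) (by omega)
            rwa [List.getD_cons_succ] at this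
      · rw [if_neg hx, zero_mul, hI0]
        intro h'
        exact hx (by have := h' 0 (by omega); rwa [List.getD_cons_zero] at this)
    rw [Function.iterate_succ_apply', hFs]
    simp only [List.getD_cons_succ, hcons, mul_assoc]
    rw [Finset.sum_congr rfl fun y _ => smul hF0 hFs T y _ _, ← Finset.mul_sum]
    by_cases hx : ins x
    · rw [hΦ, if_pos hx, if_pos hx, one_mul]
      exact congrArg (· / _) (Finset.sum_congr rfl fun y _ => ih y)
    · rw [hΦ, if_neg hx, if_neg hx, zero_mul, zero_div]

end StubPathFunctionalBasics

open StubPathFunctionalBasics in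
/-- **Stub `stub_pathFunctionalBasics`** of the crux `VerticalGamblersRuin` (line `registered`,
rev 8; exact registered signature): **the elementary algebra of the quenched path functional.**
`E ω T x G` is the expectation of `G [X_0, …, X_T]` for the SRW on the open lattice edges of `ω`
started at `x`, pinned by its first-step recursion `hE0`/`hEs` (sub-probability, `0/0 = 0`).  For
all `ω`, `T`, `x`: `E ω T x` is monotone, linear and nonnegative in `G`, has mass `≤ 1`, and mass
`= 1` as soon as `x` has an open lattice neighbour; `E ω T x G` only depends on `G` on lattice lists
of length `T + 1` with head `x`; and the LINKS with the iterated one-step averaging operators,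
unkilled `(𝒫_ω^T f)(x) = E ω T x (l ↦ f x_T)` and killed outside `(-m, m)`:
`(𝒦_ω^T f)(x) = E ω T x (l ↦ (∏_{t<T} 1_{-m < h(x_t) < m}) · f(x_T))`.  Proof: the abstract
lemmas of `StubPathFunctionalBasics` (and `StubForwardKolmogorov.mono`,
`StubForwardKolmogorov.mass_one`) for `V = ℤ³`, `N x = N_ω(x)` (symmetric: adjacency is symmetric
and `s(x, y) = s(y, x)`), `F = E ω`. -/
theorem stub_pathFunctionalBasics :
    ∀ E : BondConfig (Site 3) → ℕ → Site 3 → (List (Site 3) → ℝ) → ℝ,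
      (∀ ω (x : Site 3) (G : List (Site 3) → ℝ), E ω 0 x G = G [x]) →
      (∀ ω (T : ℕ) (x : Site 3) (G : List (Site 3) → ℝ), E ω (T + 1) x G =
        (∑ y ∈ ((zdGraph 3).neighborFinset x).filter (fun y => s(x, y) ∈ ω),
            E ω T y (fun l => G (x :: l))) /
          ((((zdGraph 3).neighborFinset x).filter (fun y => s(x, y) ∈ ω)).card : ℝ)) →
    ∀ (ω : BondConfig (Site 3)) (T : ℕ) (x : Site 3),
      (∀ G G' : List (Site 3) → ℝ, (∀ l, G l ≤ G' l) → E ω T x G ≤ E ω T x G') ∧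
      (∀ (G G' : List (Site 3) → ℝ) (a b : ℝ),
        E ω T x (fun l => a * G l + b * G' l) = a * E ω T x G + b * E ω T x G') ∧
      (∀ G : List (Site 3) → ℝ, (∀ l, 0 ≤ G l) → 0 ≤ E ω T x G) ∧
      (E ω T x (fun _ => (1 : ℝ)) ≤ 1) ∧
      (1 ≤ (((zdGraph 3).neighborFinset x).filter (fun y => s(x, y) ∈ ω)).card →
        E ω T x (fun _ => (1 : ℝ)) = 1) ∧
      (∀ G G' : List (Site 3) → ℝ,
        (∀ l : List (Site 3), l.length = T + 1 → l.getD 0 0 = x → G l = G' l) →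
        E ω T x G = E ω T x G') ∧
      (∀ Pop : BondConfig (Site 3) → (Site 3 → ℝ) → Site 3 → ℝ,
        (∀ ω' (g : Site 3 → ℝ) (z : Site 3), Pop ω' g z =
          (∑ y ∈ ((zdGraph 3).neighborFinset z).filter (fun y => s(z, y) ∈ ω'), g y) /
            ((((zdGraph 3).neighborFinset z).filter (fun y => s(z, y) ∈ ω')).card : ℝ)) →
        ∀ f : Site 3 → ℝ, ((Pop ω)^[T] f) x = E ω T x (fun l => f (l.getD T 0))) ∧
      (∀ (m : ℕ) (Kop : BondConfig (Site 3) → (Site 3 → ℝ) → Site 3 → ℝ),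
        (∀ ω' (g : Site 3 → ℝ) (z : Site 3), Kop ω' g z =
          if -(m : ℤ) < z 0 ∧ z 0 < (m : ℤ) then
            (∑ y ∈ ((zdGraph 3).neighborFinset z).filter (fun y => s(z, y) ∈ ω'), g y) /
              ((((zdGraph 3).neighborFinset z).filter (fun y => s(z, y) ∈ ω')).card : ℝ)
          else 0) →
        ∀ f : Site 3 → ℝ, ((Kop ω)^[T] f) x =
          E ω T x (fun l => (if ∀ t < T, -(m : ℤ) < (l.getD t 0) 0 ∧ (l.getD t 0) 0 < (m : ℤ)
            then (1 : ℝ) else 0) * f (l.getD T 0))) := by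
  intro E hE0 hEs ω T x
  have hsymm : ∀ x' y : Site 3,
      y ∈ ((zdGraph 3).neighborFinset x').filter (fun y => s(x', y) ∈ ω) →
      x' ∈ ((zdGraph 3).neighborFinset y).filter (fun y' => s(y, y') ∈ ω) := by
    intro x' y hy
    rw [Finset.mem_filter, SimpleGraph.mem_neighborFinset] at hy ⊢
    exact ⟨hy.1.symm, by rw [Sym2.eq_swap]; exact hy.2⟩
  refine ⟨fun G G' h => StubForwardKolmogorov.mono (hE0 ω) (hEs ω) T x h,
    fun G G' a b => linear (hE0 ω) (hEs ω) T x G G' a b,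
    fun G h => nonneg (hE0 ω) (hEs ω) T x h,
    mass_le_one (hE0 ω) (hEs ω) T x,
    fun hx =>
      StubForwardKolmogorov.mass_one (hE0 ω) (hEs ω) hsymm T x (Finset.card_pos.mp hx),
    fun G G' h => congr_path (v₀ := (0 : Site 3)) (hE0 ω) (hEs ω) T x h,
    fun Pop hPop f => iterate_full (v₀ := (0 : Site 3)) (hE0 ω) (hEs ω) (hPop ω) T f x,
    fun m Kop hKop f => ?_⟩
  exact iterate_killed (v₀ := (0 : Site 3)) (hE0 ω) (hEs ω) (hKop ω)
    (I := fun T' l => if ∀ t < T', -(m : ℤ) < (l.getD t 0) 0 ∧ (l.getD t 0) 0 < (m : ℤ)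
      then (1 : ℝ) else 0)
    (fun _ _ h => if_pos h) (fun _ _ h => if_neg h) T f x

end Summit.CriticalPhenomena.PercolationContinuityZ3.Theorems.VerticalGamblersRuin
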